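import Mathlib
import Literature.Analysis.FunctionSpaces.TorusFourierModes
import Literature.Analysis.FunctionSpaces.TorusFourierCalculus
import Literature.Analysis.FunctionSpaces.TorusEnstrophyOrthogonality

/-!
# Phantom floor law — support II: truncations of an `L²` field

Support for `Theorems/TaylorCertificatesPhantomFloorLaw.lean` (stmt-AnomalousDissipation-14033). Band-limited
fields: `‖∇u‖₂² ≤ 4π²L² ∫‖u‖²` (Bernstein in `L²`); consequences for the Fourier truncations `P_M v` of an `L²`
field (`‖∇P_M v‖₂² ≤ 4π²M²‖v‖₂²`, quantitative `P_M v → v` in `L²`, zero mean); reading band limits off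
`P_L u = u` and `P_L u = 0`.
-/

noncomputable section

-- `Summit.<Summit>.<Sub>` repeats `AnomalousDissipation` by the tree's layout (D-0017), as in the sibling files.
set_option linter.dupNamespace false

open MeasureTheory Filter Topology UnitAddTorus
open scoped InnerProductSpace ENNReal

namespace Summit.AnomalousDissipation.AnomalousDissipation.Theorems.PhantomFloor

open Literature.Analysis.FunctionSpaces

/-! ## Band-limited fields: enstrophy against energy -/

/-- **Bernstein in `L²` for band-limited fields**: if the continuous field `u` has no Fourier modes with
`|k|² > L²`, then `‖∇u‖₂² ≤ 4π² L² ∫ ‖u‖²`. -/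
theorem toReal_eGradNormSq_le_of_band_limited {u : (UnitAddTorus (Fin 3)) → (EuclideanSpace ℝ (Fin 3))} (hu : Continuous u) {L : ℕ}
    (hband : ∀ k, (L : ℝ) ^ 2 < Torus.freqNormSq k → mFourierCoeff (EuclideanSpace.complexify ∘ u) k = 0) :
    (Torus.eGradNormSq u).toReal ≤ 4 * Real.pi ^ 2 * (L : ℝ) ^ 2 * ∫ x, ‖u x‖ ^ 2 := by
  have hnn : ∀ k ∈ Torus.freqBall (d := Fin 3) L,
      0 ≤ Torus.freqNormSq k * ‖mFourierCoeff (EuclideanSpace.complexify ∘ u) k‖ ^ 2 :=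
    fun k _ => mul_nonneg (Torus.freqNormSq_nonneg k) (sq_nonneg _)
  rw [Torus.eGradNormSq_eq_sum_of_band_limited hu hband, ENNReal.toReal_ofReal
      (mul_nonneg (by positivity) (Finset.sum_nonneg hnn)),
    Torus.integral_norm_sq_eq_sum_of_band_limited hu hband]
  have hsum : ∑ k ∈ Torus.freqBall L, Torus.freqNormSq k * ‖mFourierCoeff (EuclideanSpace.complexify ∘ u) k‖ ^ 2 ≤
      (L : ℝ) ^ 2 * ∑ k ∈ Torus.freqBall L, ‖mFourierCoeff (EuclideanSpace.complexify ∘ u) k‖ ^ 2 := by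
    rw [Finset.mul_sum]
    exact Finset.sum_le_sum fun k hk => mul_le_mul_of_nonneg_right (Torus.mem_freqBall.1 hk) (sq_nonneg _)
  have hπ : (0 : ℝ) ≤ 4 * Real.pi ^ 2 := by positivity
  calc 4 * Real.pi ^ 2 * ∑ k ∈ Torus.freqBall L, Torus.freqNormSq k * ‖mFourierCoeff (EuclideanSpace.complexify ∘ u) k‖ ^ 2
      ≤ 4 * Real.pi ^ 2 * ((L : ℝ) ^ 2 * ∑ k ∈ Torus.freqBall L, ‖mFourierCoeff (EuclideanSpace.complexify ∘ u) k‖ ^ 2) :=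
        mul_le_mul_of_nonneg_left hsum hπ
    _ = _ := by ring

/-- The same bound for the derivative-based gradient norm of a smooth band-limited field. -/
theorem gradNormSq_le_of_band_limited {u : (UnitAddTorus (Fin 3)) → (EuclideanSpace ℝ (Fin 3))} (hu : Torus.IsSmooth u) {L : ℕ}
    (hband : ∀ k, (L : ℝ) ^ 2 < Torus.freqNormSq k → mFourierCoeff (EuclideanSpace.complexify ∘ u) k = 0) :
    Torus.gradNormSq u ≤ 4 * Real.pi ^ 2 * (L : ℝ) ^ 2 * ∫ x, ‖u x‖ ^ 2 := by
  rw [Torus.gradNormSq_eq_toReal_eGradNormSq_holds hu]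
  exact toReal_eGradNormSq_le_of_band_limited hu.continuous hband

/-- A field equal to its truncation at level `L` is band-limited at `L`. -/
theorem band_limited_of_fourierTruncate_eq {u : (UnitAddTorus (Fin 3)) → (EuclideanSpace ℝ (Fin 3))} {L : ℕ} (h : Torus.fourierTruncate L u = u) :
    ∀ k, (L : ℝ) ^ 2 < Torus.freqNormSq k → mFourierCoeff (EuclideanSpace.complexify ∘ u) k = 0 := by
  intro k hk
  rw [← h, Torus.fourierTruncate_eq]
  exact Torus.mFourierCoeff_realTrigPoly_freqBall_eq_zero _ hk

/-- A field whose truncation at level `L` vanishes has no modes in the ball of radius `L`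
(for integrable `u`). -/
theorem mFourierCoeff_eq_zero_of_fourierTruncate_eq_zero {u : (UnitAddTorus (Fin 3)) → (EuclideanSpace ℝ (Fin 3))} (hu : Integrable u volume) {L : ℕ}
    (h : Torus.fourierTruncate L u = 0) {k : Fin 3 → ℤ} (hk : k ∈ Torus.freqBall L) :
    mFourierCoeff (EuclideanSpace.complexify ∘ u) k = 0 := by
  have h1 := Torus.mFourierCoeff_fourierTruncate hu L k
  rw [if_pos hk, h] at h1
  rw [← h1]
  have : (EuclideanSpace.complexify ∘ (0 : (UnitAddTorus (Fin 3)) → (EuclideanSpace ℝ (Fin 3)))) = fun _ => (0 : EuclideanSpace ℂ (Fin 3)) := by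
    funext x; simp
  rw [this]
  simp [mFourierCoeff]

/-! ## Truncations of an `L²` field -/

/-- Truncations are band-limited. -/
theorem band_limited_fourierTruncate (M : ℕ) (v : (UnitAddTorus (Fin 3)) → (EuclideanSpace ℝ (Fin 3))) :
    ∀ k, (M : ℝ) ^ 2 < Torus.freqNormSq k →
      mFourierCoeff (EuclideanSpace.complexify ∘ Torus.fourierTruncate M v) k = 0 :=
  fun _ hk => Torus.mFourierCoeff_realTrigPoly_freqBall_eq_zero _ hk

/-- **Crude quietness**: `‖∇P_M v‖₂² ≤ 4π² M² ∫‖v‖²` for `v ∈ L²`. -/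
theorem gradNormSq_fourierTruncate_le {v : (UnitAddTorus (Fin 3)) → (EuclideanSpace ℝ (Fin 3))} (hv : MemLp v 2 volume) (M : ℕ) :
    Torus.gradNormSq (Torus.fourierTruncate M v) ≤ 4 * Real.pi ^ 2 * (M : ℝ) ^ 2 * ∫ x, ‖v x‖ ^ 2 :=
  (gradNormSq_le_of_band_limited (Torus.isSmooth_fourierTruncate M v) (band_limited_fourierTruncate M v)).trans
    (mul_le_mul_of_nonneg_left (Torus.integral_norm_sq_fourierTruncate_le hv M) (by positivity))

/-- **`P_M v → v` in `L²`, quantitatively**: for `v ∈ L²` and `δ > 0` some `M ≥ 1` has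
`∫ ‖P_M v − v‖² ≤ δ`. -/
theorem exists_fourierTruncate_close {v : (UnitAddTorus (Fin 3)) → (EuclideanSpace ℝ (Fin 3))} (hv : MemLp v 2 volume) {δ : ℝ} (hδ : 0 < δ) :
    ∃ M : ℕ, 1 ≤ M ∧ ∫ x, ‖Torus.fourierTruncate M v x - v x‖ ^ 2 ≤ δ := by
  -- real-integral form of `Torus.tendsto_lintegral_enorm_sq_fourierTruncate_sub`
  have h := Torus.tendsto_lintegral_enorm_sq_fourierTruncate_sub hv
  have h2 := (ENNReal.tendsto_toReal ENNReal.zero_ne_top).comp h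
  rw [ENNReal.toReal_zero] at h2
  have h3 : Tendsto (fun N => ∫ x, ‖Torus.fourierTruncate N v x - v x‖ ^ 2) atTop (𝓝 0) := by
    refine h2.congr fun N => ?_
    have hm : AEStronglyMeasurable (fun x => Torus.fourierTruncate N v x - v x) volume :=
      (Torus.continuous_fourierTruncate N v).aestronglyMeasurable.sub hv.1
    have hm2 : AEStronglyMeasurable (fun x => ‖Torus.fourierTruncate N v x - v x‖ ^ 2) volume :=
      (hm.norm.aemeasurable.pow_const 2).aestronglyMeasurable
    rw [Function.comp_apply, integral_eq_lintegral_of_nonneg_ae (Eventually.of_forall fun x => sq_nonneg _) hm2]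
    congr 1
    exact lintegral_congr fun x => by rw [ENNReal.ofReal_pow (norm_nonneg _), ofReal_norm]
  have hev := (h3.eventually (Iio_mem_nhds hδ))
  obtain ⟨M₀, hM₀⟩ := Filter.eventually_atTop.1 hev
  exact ⟨max M₀ 1, le_max_right _ _, (hM₀ _ (le_max_left _ _)).le⟩

/-- The zero Fourier mode of a mean-zero integrable field vanishes. -/
theorem mFourierCoeff_zero_of_hasZeroMean {v : (UnitAddTorus (Fin 3)) → (EuclideanSpace ℝ (Fin 3))} (h0 : Torus.HasZeroMean v) :
    mFourierCoeff (EuclideanSpace.complexify ∘ v) 0 = 0 := by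
  rw [Torus.mFourierCoeff_eq_integral_volume]
  simp only [neg_zero, mFourier_zero, ContinuousMap.one_apply, one_smul, Function.comp_apply]
  rw [EuclideanSpace.complexify.integral_comp_comm v, show (∫ x, v x) = 0 from h0, map_zero]

/-- Truncations of a mean-zero integrable field have zero mean. -/
theorem hasZeroMean_fourierTruncate {v : (UnitAddTorus (Fin 3)) → (EuclideanSpace ℝ (Fin 3))} (hv : Integrable v volume) (h0 : Torus.HasZeroMean v)
    (M : ℕ) : Torus.HasZeroMean (Torus.fourierTruncate M v) := by
  unfold Torus.HasZeroMean
  have h1 : mFourierCoeff (EuclideanSpace.complexify ∘ Torus.fourierTruncate M v) 0 = 0 := by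
    rw [Torus.mFourierCoeff_fourierTruncate hv, if_pos (Torus.zero_mem_freqBall M),
      mFourierCoeff_zero_of_hasZeroMean h0]
  rw [Torus.mFourierCoeff_eq_integral_volume] at h1
  simp only [neg_zero, mFourier_zero, ContinuousMap.one_apply, one_smul, Function.comp_apply] at h1
  rw [EuclideanSpace.complexify.integral_comp_comm (Torus.fourierTruncate M v)] at h1
  exact EuclideanSpace.complexify_injective (h1.trans (map_zero _).symm)

end Summit.AnomalousDissipation.AnomalousDissipation.Theorems.PhantomFloor
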